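import Literature.NumberTheory.Sieve.FriedlanderIwaniecPrimesJacobiTwistedFlip
import Literature.NumberTheory.Sieve.FriedlanderIwaniecPrimesJacobiTwistedBilinearClasses
import Literature.NumberTheory.Sieve.FriedlanderIwaniecPrimesJacobiTwistedExcision
import HarnessLib

/-!
# Friedlander–Iwaniec, *The polynomial `X² + Y⁴` captures its primes*, §12: (12.2) and (12.6)–(12.7) —
# from `V(D)` to the smoothed, excised, flipped bilinear form

[FI, §12, pp. 49–50 of arXiv:math/9811185 = Ann. of Math. (2) 148 (1998), 945–1040].
(12.1)–(12.2): "by splitting into four residue classes we can assume without loss of generality that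
`r` is fixed modulo eight.  We have by the reciprocity law `(r/d') = ±(d/r)` where `±` depends on `d`
and on `r (mod 8)` but not on `r` in any other fashion.  Therefore `V(D)` for our vectors can be
written as (12.2) `V(D) = ∑_{D<d≤2D} ∑_{a (mod d)} |∑_{r̄s ≡ a (mod d)} α_{rs} (d/r)|²`."
(12.6): "We begin by attaching to `V(D)` a smooth majorant `f(y)` supported on `D/2 ≤ y ≤ 3D`, then
we square out getting `V(D) ≤ ∑_d f(d) ∑∑_{r₁s₂ ≡ r₂s₁ (mod d)} α_{r₁s₁} ᾱ_{r₂s₂} (d/(r₁r₂))`.  Next we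
remove the terms near the diagonal … the factor `g(|s₁/r₁ − s₂/r₂|)` may be inserted into (12.6)
without alteration, except for the points … with `|s₁/r₁ − s₂/r₂| < 2S/(HR)`.  The contribution of
these exceptional points is estimated trivially by (12.7)."

This file PROVES:

* `jtV_le_of_jtVflip_le` — the converse transfer to the tree's `jtVflip_le_of_jtV_le`: a bound for the
  FLIPPED form (symbol `(d/r)`), valid for all vectors supported in a support class `P` and on ONE
  residue class of `r` modulo `8`, gives the same bound with a factor `4` for `V(D) = jtV` (symbol
  `(r/d')`) and every vector supported in `P` on odd `r` (Cauchy–Schwarz over the four classes);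
* `jtVflip_le_smooth_excised` — (12.6)–(12.7): for `α` supported on `(r, s) = 1`, a majorant
  `0 ≤ F ≤ 1`, `F = 1` on `[1,2]`, `F = 0` off `(1/2, 5/2)` (tree: `exists_majorant_mellinKernel`), and
  a cutoff `0 ≤ g ≤ 1` with `g = 1` on `[2a, 2S/R]` (tree: `exists_cutoff_fourierKernel`,
  `a = S/(HR)`), the flipped form over `D < d ≤ 2D` is at most
  `|∑_{d ≤ N} F(d/D) ∑∑_{d ∣ r₁s₂−r₂s₁} α_{r₁s₁}ᾱ_{r₂s₂} (d/(r₁r₂)) g(|s₁/r₁ − s₂/r₂|)|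
     + (3D + 48aR²(1 + log(1 + 16R²a/D)) + 48(R²a/D)√(RS)) ‖α‖²`
  (squaring out by the tree's `bilinear_congr_eq_sum_classes`; the exceptional points by
  `sum_nearDiagonal_norm_le`).  With `a = S/(HR)` the error is FI's
  `(D + H⁻¹RS log 2RS + H⁻¹D⁻¹(RS)^{3/2})‖α‖²` up to constants.

No definitions, no named facts.  With `…JacobiTwistedFlipReduction` ((12.8)–(12.11)) and the kernels
of `…SmoothMajorantMellinKernel`, `…CutoffFourierKernel` ((12.13)–(12.14)) this leaves, of the proof
of Proposition 12.1, only the final assembly (12.15)–(12.17) (HOME/parity-ideate-lit/FI98-Prop121-MAP.md).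

## References

* J. Friedlander, H. Iwaniec, *The polynomial `X² + Y⁴` captures its primes*, Ann. of Math. (2) 148
  (1998), 945–1040, §12, (12.1)–(12.2), (12.6)–(12.7). [FriedlanderIwaniecAnnals1998]

## Tree / Mathlib

Tree: `jacobiSym_flip_mod_eight`, `jtV_def`, `jtChar` (`…JacobiTwistedFlip`, `…Forms`),
`norm_sum_sq_le_card_mul` (`…Symmetry`), `bilinear_congr_eq_sum_classes` (`…BilinearClasses`),
`sum_nearDiagonal_norm_le'` (`…Excision`). Mathlib: `qrSign.sq_eq_one`, `ZMod.χ₈_nat_eq_if_mod_eight`,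
`jacobiSym.mul_right'`, `jacobiSym.eq_zero_iff`, `Complex.mul_conj`, `Complex.normSq_eq_norm_sq`.
-/

noncomputable section

open Finset Real Complex
open scoped NumberTheorySymbols ArithmeticFunction.sigma Nat ComplexConjugate

namespace Literature.NumberTheory.Sieve.FriedlanderIwaniecPrimes

/-! ### (12.2) in the converse direction: from the flipped form back to `V(D)` -/

/-- The odd part of `d ≠ 0` is odd. [folklore] -/
private theorem odd_ordCompl_two'' {d : ℕ} (hd : d ≠ 0) : Odd (ordCompl[2] d) := by
  rw [Nat.odd_iff]
  have h := Nat.coprime_ordCompl Nat.prime_two hd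
  have h2 : ¬ 2 ∣ ordCompl[2] d := by
    intro hdvd
    have := Nat.Coprime.eq_one_of_dvd (Nat.Coprime.symm h |>.symm) hdvd
    omega
  omega

/-- For odd `c` the sign `χ₈(c)^k qrSign(c, d')` squares to one. [folklore] -/
private theorem flipSign_sq_eq_one {d c : ℕ} (hd : d ≠ 0) (hc : Odd c) :
    (ZMod.χ₈ ((c : ℕ) : ZMod 8) ^ (d.factorization 2) * qrSign c (ordCompl[2] d)) ^ 2 = 1 := by
  have h1 : (ZMod.χ₈ ((c : ℕ) : ZMod 8)) ^ 2 = 1 := by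
    rw [ZMod.χ₈_nat_eq_if_mod_eight]
    have h2 : c % 2 = 1 := Nat.odd_iff.mp hc
    rw [if_neg (by omega)]
    split_ifs <;> norm_num
  have h2 : (qrSign c (ordCompl[2] d)) ^ 2 = 1 := qrSign.sq_eq_one hc (odd_ordCompl_two'' hd)
  rw [mul_pow, ← pow_mul, mul_comm (d.factorization 2) 2, pow_mul, h1, one_pow, one_mul, h2]

/-- The flip read backwards: `(r/d') = χ₈(r)^k qrSign(r, d') · (d/r)` for odd `r`, `d ≥ 1` (the sign
being `±1`). [cite: FriedlanderIwaniecAnnals1998, §12, (12.2)] -/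
theorem jtChar_eq_flipSign_mul_jacobiSym {d r : ℕ} (hd : d ≠ 0) (hr : Odd r) :
    jtChar d r = ZMod.χ₈ ((r % 8 : ℕ) : ZMod 8) ^ (d.factorization 2) *
      qrSign (r % 8) (ordCompl[2] d) * J((d : ℤ) | r) := by
  have h := jacobiSym_flip_mod_eight hd hr
  have hodd : Odd (r % 8) := by
    rw [Nat.odd_iff] at hr ⊢
    omega
  have hsq := flipSign_sq_eq_one hd hodd
  rw [h, ← mul_assoc, ← sq, hsq, one_mul]

/-- For an odd `r`, `r % 8 ∈ {1, 3, 5, 7}`. [folklore] -/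
private theorem mod_eight_mem_of_odd' {r : ℕ} (hr : Odd r) : r % 8 ∈ ({1, 3, 5, 7} : Finset ℕ) := by
  simp only [mem_insert, mem_singleton]
  rcases hr with ⟨k, rfl⟩
  omega

/-- The sign has complex norm at most one. [folklore] -/
private theorem norm_flipSign_le_one' (d c : ℕ) :
    ‖((ZMod.χ₈ ((c : ℕ) : ZMod 8) ^ (d.factorization 2) * qrSign c (ordCompl[2] d) : ℤ) : ℂ)‖ ≤ 1 := by
  rw [Int.cast_mul, Int.cast_pow, norm_mul, norm_pow]
  have h1 : ‖((ZMod.χ₈ ((c : ℕ) : ZMod 8) : ℤ) : ℂ)‖ ≤ 1 := by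
    rw [ZMod.χ₈_nat_eq_if_mod_eight]
    split_ifs <;> simp
  have h2 : ‖((qrSign c (ordCompl[2] d) : ℤ) : ℂ)‖ ≤ 1 := by
    have ht := jacobiSym.trichotomy (ZMod.χ₄ (c : ZMod 4)) (ordCompl[2] d)
    change qrSign c (ordCompl[2] d) = 0 ∨ qrSign c (ordCompl[2] d) = 1 ∨
      qrSign c (ordCompl[2] d) = -1 at ht
    rcases ht with h | h | h <;> simp [h]
  calc ‖((ZMod.χ₈ ((c : ℕ) : ZMod 8) : ℤ) : ℂ)‖ ^ d.factorization 2 *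
        ‖((qrSign c (ordCompl[2] d) : ℤ) : ℂ)‖
      ≤ 1 ^ d.factorization 2 * 1 := by
        gcongr
    _ = 1 := by simp

/-- **(12.2), converse transfer.** If the FLIPPED form (symbol `(d/r)`) satisfies
`∑_{D₁<d≤D₂} ∑_{a (mod d)} |∑_{r̄s≡a (d)} β_{rs}(d/r)|² ≤ Δ ∑∑ w(r,s)|β_{rs}|²` for all `β` supported in
`P` with all `r` of the support in ONE class modulo `8`, then `V(D) = jtV` (symbol `(r/d')`) satisfies
the same bound with `4Δ` for every `α` supported in `P` on odd `r` ("by splitting into four residue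
classes we can assume … that `r` is fixed modulo eight … `(r/d') = ±(d/r)`").
[cite: FriedlanderIwaniecAnnals1998, §12, (12.1)–(12.2)] -/
theorem jtV_le_of_jtVflip_le {D₁ D₂ R S : ℕ} {Δ : ℝ} {w : ℕ → ℕ → ℝ} {P : ℕ → ℕ → Prop}
    (hB : ∀ β : ℕ → ℕ → ℂ, (∀ r s, β r s ≠ 0 → P r s) →
      (∀ r₁ s₁ r₂ s₂, β r₁ s₁ ≠ 0 → β r₂ s₂ ≠ 0 → r₁ % 8 = r₂ % 8) →
      ∑ d ∈ Ioc D₁ D₂, ∑ a ∈ range d, ‖∑ r ∈ Ioc R (2 * R), ∑ s ∈ Ioc S (2 * S),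
        (if r.Coprime d ∧ (d : ℤ) ∣ (s : ℤ) - (a : ℤ) * r then β r s * (J((d : ℤ) | r) : ℂ) else 0)‖ ^ 2
        ≤ Δ * ∑ r ∈ Ioc R (2 * R), ∑ s ∈ Ioc S (2 * S), w r s * ‖β r s‖ ^ 2)
    {α : ℕ → ℕ → ℂ} (hP : ∀ r s, α r s ≠ 0 → P r s) (hodd : ∀ r s, α r s ≠ 0 → Odd r) :
    jtV D₁ D₂ R S α ≤ 4 * Δ * ∑ r ∈ Ioc R (2 * R), ∑ s ∈ Ioc S (2 * S), w r s * ‖α r s‖ ^ 2 := by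
  classical
  set C : Finset ℕ := {1, 3, 5, 7} with hC
  have hCcard : #C = 4 := by rw [hC]; decide
  set αc : ℕ → ℕ → ℕ → ℂ := fun c r s => if r % 8 = c then α r s else 0 with hαc
  set ε : ℕ → ℕ → ℂ := fun d c =>
    ((ZMod.χ₈ ((c : ℕ) : ZMod 8) ^ (d.factorization 2) * qrSign c (ordCompl[2] d) : ℤ) : ℂ) with hε
  have hεle : ∀ d c, ‖ε d c‖ ≤ 1 := fun d c => norm_flipSign_le_one' d c
  -- Step A: pointwise, `α (r/d') = ∑_c ε(d,c) α_c (d/r)`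
  have hptw : ∀ d : ℕ, d ≠ 0 → ∀ (a r s : ℕ),
      (if r.Coprime d ∧ (d : ℤ) ∣ (s : ℤ) - (a : ℤ) * r then α r s * (jtChar d r : ℂ) else 0) =
        ∑ c ∈ C, ε d c *
          (if r.Coprime d ∧ (d : ℤ) ∣ (s : ℤ) - (a : ℤ) * r then αc c r s * (J((d : ℤ) | r) : ℂ)
            else 0) := by
    intro d hd a r s
    by_cases hα : α r s = 0
    · have h0 : ∀ c, αc c r s = 0 := fun c => by simp [hαc, hα]
      simp [hα, h0]
    have hr : Odd r := hodd r s hα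
    have hmem : r % 8 ∈ C := mod_eight_mem_of_odd' hr
    rw [Finset.sum_eq_single (r % 8)]
    · have hcc : αc (r % 8) r s = α r s := by simp [hαc]
      rw [hcc]
      split_ifs with hcond
      · rw [jtChar_eq_flipSign_mul_jacobiSym hd hr]
        simp only [hε]
        push_cast
        ring
      · simp
    · intro c _ hc
      have : αc c r s = 0 := by
        simp only [hαc]
        rw [if_neg (Ne.symm hc)]
      simp [this]
    · intro h; exact absurd hmem h
  -- Step B/C: Cauchy–Schwarz over the four classes
  have hinner : ∀ d ∈ Ioc D₁ D₂, ∀ a : ℕ,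
      ‖∑ r ∈ Ioc R (2 * R), ∑ s ∈ Ioc S (2 * S),
          (if r.Coprime d ∧ (d : ℤ) ∣ (s : ℤ) - (a : ℤ) * r then α r s * (jtChar d r : ℂ) else 0)‖ ^ 2
        ≤ 4 * ∑ c ∈ C, ‖∑ r ∈ Ioc R (2 * R), ∑ s ∈ Ioc S (2 * S),
          (if r.Coprime d ∧ (d : ℤ) ∣ (s : ℤ) - (a : ℤ) * r then αc c r s * (J((d : ℤ) | r) : ℂ)
            else 0)‖ ^ 2 := by
    intro d hd a
    have hd0 : d ≠ 0 := by have := (mem_Ioc.1 hd).1; omega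
    have hrew : ∑ r ∈ Ioc R (2 * R), ∑ s ∈ Ioc S (2 * S),
        (if r.Coprime d ∧ (d : ℤ) ∣ (s : ℤ) - (a : ℤ) * r then α r s * (jtChar d r : ℂ) else 0) =
        ∑ c ∈ C, ε d c * ∑ r ∈ Ioc R (2 * R), ∑ s ∈ Ioc S (2 * S),
          (if r.Coprime d ∧ (d : ℤ) ∣ (s : ℤ) - (a : ℤ) * r then αc c r s * (J((d : ℤ) | r) : ℂ)
            else 0) := by
      simp_rw [hptw d hd0 a, Finset.mul_sum]
      calc _ = ∑ r ∈ Ioc R (2 * R), ∑ c ∈ C, ∑ s ∈ Ioc S (2 * S), ε d c *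
            (if r.Coprime d ∧ (d : ℤ) ∣ (s : ℤ) - (a : ℤ) * r then αc c r s * (J((d : ℤ) | r) : ℂ)
              else 0) :=
            Finset.sum_congr rfl fun r _ => Finset.sum_comm
        _ = _ := Finset.sum_comm
    rw [hrew]
    calc ‖∑ c ∈ C, ε d c * ∑ r ∈ Ioc R (2 * R), ∑ s ∈ Ioc S (2 * S),
            (if r.Coprime d ∧ (d : ℤ) ∣ (s : ℤ) - (a : ℤ) * r then αc c r s * (J((d : ℤ) | r) : ℂ)
              else 0)‖ ^ 2
        ≤ #C * ∑ c ∈ C, ‖ε d c * ∑ r ∈ Ioc R (2 * R), ∑ s ∈ Ioc S (2 * S),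
            (if r.Coprime d ∧ (d : ℤ) ∣ (s : ℤ) - (a : ℤ) * r then αc c r s * (J((d : ℤ) | r) : ℂ)
              else 0)‖ ^ 2 :=
          norm_sum_sq_le_card_mul C _
      _ ≤ 4 * ∑ c ∈ C, ‖∑ r ∈ Ioc R (2 * R), ∑ s ∈ Ioc S (2 * S),
            (if r.Coprime d ∧ (d : ℤ) ∣ (s : ℤ) - (a : ℤ) * r then αc c r s * (J((d : ℤ) | r) : ℂ)
              else 0)‖ ^ 2 := by
          rw [hCcard]
          push_cast
          gcongr with c hc
          rw [norm_mul]
          exact mul_le_of_le_one_left (norm_nonneg _) (hεle d c)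
  -- Step D: `jtV(α) ≤ 4 ∑_c (flipped form of α_c)`
  have hD : jtV D₁ D₂ R S α ≤ 4 * ∑ c ∈ C, ∑ d ∈ Ioc D₁ D₂, ∑ a ∈ range d,
      ‖∑ r ∈ Ioc R (2 * R), ∑ s ∈ Ioc S (2 * S),
        (if r.Coprime d ∧ (d : ℤ) ∣ (s : ℤ) - (a : ℤ) * r then αc c r s * (J((d : ℤ) | r) : ℂ)
          else 0)‖ ^ 2 := by
    rw [jtV_def]
    calc _ ≤ ∑ d ∈ Ioc D₁ D₂, ∑ a ∈ range d, 4 * ∑ c ∈ C, ‖∑ r ∈ Ioc R (2 * R), ∑ s ∈ Ioc S (2 * S),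
          (if r.Coprime d ∧ (d : ℤ) ∣ (s : ℤ) - (a : ℤ) * r then αc c r s * (J((d : ℤ) | r) : ℂ)
            else 0)‖ ^ 2 :=
          Finset.sum_le_sum fun d hd => Finset.sum_le_sum fun a _ => hinner d hd a
      _ = _ := by
          simp_rw [Finset.mul_sum]
          calc _ = ∑ d ∈ Ioc D₁ D₂, ∑ c ∈ C, ∑ a ∈ range d, 4 * ‖∑ r ∈ Ioc R (2 * R),
                ∑ s ∈ Ioc S (2 * S),
                (if r.Coprime d ∧ (d : ℤ) ∣ (s : ℤ) - (a : ℤ) * r then αc c r s * (J((d : ℤ) | r) : ℂ)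
                  else 0)‖ ^ 2 :=
                Finset.sum_congr rfl fun d _ => Finset.sum_comm
            _ = _ := Finset.sum_comm
  -- Step E: the hypothesis on each class
  have hE : ∀ c ∈ C, ∑ d ∈ Ioc D₁ D₂, ∑ a ∈ range d,
      ‖∑ r ∈ Ioc R (2 * R), ∑ s ∈ Ioc S (2 * S),
        (if r.Coprime d ∧ (d : ℤ) ∣ (s : ℤ) - (a : ℤ) * r then αc c r s * (J((d : ℤ) | r) : ℂ)
          else 0)‖ ^ 2 ≤
      Δ * ∑ r ∈ Ioc R (2 * R), ∑ s ∈ Ioc S (2 * S), w r s * ‖αc c r s‖ ^ 2 := by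
    intro c _
    refine hB (αc c) (fun r s h => hP r s ?_) (fun r₁ s₁ r₂ s₂ h₁ h₂ => ?_)
    · simp only [hαc] at h
      split_ifs at h with h8
      · exact h
      · exact absurd rfl h
    · simp only [hαc] at h₁ h₂
      split_ifs at h₁ h₂ with h8 h8'
      · rw [h8, h8']
      all_goals first | exact absurd rfl h₁ | exact absurd rfl h₂
  -- Step F: the class norms add up
  have hF : ∑ c ∈ C, ∑ r ∈ Ioc R (2 * R), ∑ s ∈ Ioc S (2 * S), w r s * ‖αc c r s‖ ^ 2 =
      ∑ r ∈ Ioc R (2 * R), ∑ s ∈ Ioc S (2 * S), w r s * ‖α r s‖ ^ 2 := by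
    rw [Finset.sum_comm]
    refine Finset.sum_congr rfl fun r _ => ?_
    rw [Finset.sum_comm]
    refine Finset.sum_congr rfl fun s _ => ?_
    rw [← Finset.mul_sum]
    congr 1
    by_cases hα : α r s = 0
    · have h0 : ∀ c, αc c r s = 0 := fun c => by simp [hαc, hα]
      simp [hα, h0]
    · have hr : Odd r := hodd r s hα
      rw [Finset.sum_eq_single (r % 8)]
      · simp [hαc]
      · intro c _ hc
        have : αc c r s = 0 := by
          simp only [hαc]
          rw [if_neg (Ne.symm hc)]
        simp [this]
      · intro h; exact absurd (mod_eight_mem_of_odd' hr) h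
  calc jtV D₁ D₂ R S α ≤ _ := hD
    _ ≤ 4 * ∑ c ∈ C, Δ * ∑ r ∈ Ioc R (2 * R), ∑ s ∈ Ioc S (2 * S), w r s * ‖αc c r s‖ ^ 2 := by
        gcongr with c hc
        exact hE c hc
    _ = 4 * Δ * ∑ r ∈ Ioc R (2 * R), ∑ s ∈ Ioc S (2 * S), w r s * ‖α r s‖ ^ 2 := by
        rw [← Finset.mul_sum, hF, mul_assoc]

/-! ### (12.6)–(12.7): smoothing and excision -/

/-- `|(d/r)| ≤ 1`. [folklore] -/
private theorem norm_jacobiSym_le_one' (a : ℤ) (b : ℕ) : ‖(J(a | b) : ℂ)‖ ≤ 1 := by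
  rcases jacobiSym.trichotomy a b with h | h | h <;> simp [h]

/-- On the box (11.6) the ratios `s/r` lie in `(0, 2S/R)`, so two of them differ by less than `2S/R`
("Notice that for `r₁, s₁` and `r₂, s₂` in the box (11.6) we have `|s₁/r₁ − s₂/r₂| < 2S/R`").
[cite: FriedlanderIwaniecAnnals1998, §12, before (12.7)] -/
theorem abs_sub_div_lt_of_mem_box {R S r₁ s₁ r₂ s₂ : ℕ} (hr₁ : r₁ ∈ Ioc R (2 * R))
    (hs₁ : s₁ ∈ Ioc S (2 * S)) (hr₂ : r₂ ∈ Ioc R (2 * R)) (hs₂ : s₂ ∈ Ioc S (2 * S)) :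
    |(s₁ : ℝ) / r₁ - (s₂ : ℝ) / r₂| < 2 * S / R := by
  have key : ∀ {r s : ℕ}, r ∈ Ioc R (2 * R) → s ∈ Ioc S (2 * S) →
      0 < (s : ℝ) / r ∧ (s : ℝ) / r < 2 * S / R := by
    intro r s hr hs
    have hr' := mem_Ioc.mp hr
    have hs' := mem_Ioc.mp hs
    have hR : (0 : ℝ) < R := by exact_mod_cast (show 0 < R by omega)
    have hr0 : (R : ℝ) < r := by exact_mod_cast hr'.1
    have hs0 : (0 : ℝ) < s := by exact_mod_cast (show 0 < s by omega)
    have hs2 : (s : ℝ) ≤ 2 * S := by exact_mod_cast hs'.2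
    have hS0 : (0 : ℝ) < S := by exact_mod_cast (show 0 < S by omega)
    refine ⟨div_pos hs0 (hR.trans hr0), ?_⟩
    rw [div_lt_div_iff₀ (hR.trans hr0) hR]
    calc (s : ℝ) * R ≤ 2 * S * R := by gcongr
      _ < 2 * S * r := by gcongr
  obtain ⟨h1, h2⟩ := key hr₁ hs₁
  obtain ⟨h3, h4⟩ := key hr₂ hs₂
  rw [abs_sub_lt_iff]
  constructor <;> linarith

/-- **(12.6)–(12.7)** [FI, §12]: for `α_{rs}` supported on `(r, s) = 1`, `D, S ≥ 1`, `N ≥ 2D`, a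
majorant `F` (`0 ≤ F ≤ 1`, `F = 1` on `[1, 2]`, `F = 0` off `(1/2, 5/2)`; FI's `f(d) = F(d/D)`) and a
cutoff `g` (`0 ≤ g ≤ 1`, `g = 1` on `[2a, 2S/R]`; FI: `a = S/(HR)`), the flipped form (12.2) satisfies
`V(D) ≤ |∑_{d ≤ N} F(d/D) ∑∑_{d ∣ r₁s₂−r₂s₁} α_{r₁s₁} ᾱ_{r₂s₂} (d/(r₁r₂)) g(|s₁/r₁ − s₂/r₂|)|
        + (3D + 48aR²(1 + log(1 + 16R²a/D)) + 3(16R²a/D)√(RS)) ‖α‖²`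
(square out over the classes — `V(D)`'s `d`-th term is `∑∑_{d ∣ r₁s₂−r₂s₁} α₁ᾱ₂(d/(r₁r₂)) ≥ 0` —
insert `f`, then `1 = g + (1 − g)` where `1 − g(|x|) ≠ 0` forces `|x| < 2a`, and bound the
exceptional points by `sum_nearDiagonal_norm_le`).  With `a = S/(HR)` the error term is (12.7),
`V₀(f,g) ≪ (D + H⁻¹RS log 2RS + H⁻¹D⁻¹(RS)^{3/2})‖α‖²`.
[cite: FriedlanderIwaniecAnnals1998, §12, (12.6)–(12.7)] -/
theorem jtVflip_le_smooth_excised {D R S N : ℕ} (hS : 1 ≤ S) (hN : 2 * D ≤ N)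
    (α : ℕ → ℕ → ℂ) (hα : ∀ r s, α r s ≠ 0 → r.Coprime s)
    (F : ℝ → ℝ) (hF0 : ∀ w, 0 ≤ F w) (hF1 : ∀ w, F w ≤ 1) (hF2 : ∀ w ∈ Set.Icc (1 : ℝ) 2, F w = 1)
    (hF3 : ∀ w, w ≤ 1 / 2 → F w = 0) (hF4 : ∀ w, 5 / 2 ≤ w → F w = 0)
    (g : ℝ → ℝ) (hg0 : ∀ x, 0 ≤ g x) (hg1 : ∀ x, g x ≤ 1) {a : ℝ} (ha : 0 < a)
    (hg2 : ∀ x, 2 * a ≤ x → x ≤ 2 * S / R → g x = 1) :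
    ∑ d ∈ Ioc D (2 * D), ∑ a' ∈ range d, ‖∑ r ∈ Ioc R (2 * R), ∑ s ∈ Ioc S (2 * S),
        (if r.Coprime d ∧ (d : ℤ) ∣ (s : ℤ) - (a' : ℤ) * r then α r s * (J((d : ℤ) | r) : ℂ)
          else 0)‖ ^ 2 ≤
      ‖∑ d ∈ Ioc 0 N, (F ((d : ℝ) / D) : ℂ) * ∑ r₁ ∈ Ioc R (2 * R), ∑ s₁ ∈ Ioc S (2 * S),
          ∑ r₂ ∈ Ioc R (2 * R), ∑ s₂ ∈ Ioc S (2 * S),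
          (if (d : ℤ) ∣ (r₁ : ℤ) * s₂ - (r₂ : ℤ) * s₁ then
            α r₁ s₁ * conj (α r₂ s₂) * (J((d : ℤ) | r₁ * r₂) : ℂ) *
              (g |(s₁ : ℝ) / r₁ - (s₂ : ℝ) / r₂| : ℂ) else 0)‖ +
        (3 * D + (48 * a * (R : ℝ) ^ 2 * (1 + Real.log (1 + 16 * (R : ℝ) ^ 2 * a / D)) +
          3 * (16 * (R : ℝ) ^ 2 * a / D) * Real.sqrt ((R : ℝ) * S))) *
          ∑ r ∈ Ioc R (2 * R), ∑ s ∈ Ioc S (2 * S), ‖α r s‖ ^ 2 := by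
  set IR := Ioc R (2 * R) with hIR
  set IS := Ioc S (2 * S) with hIS
  set N2 : ℝ := ∑ r ∈ IR, ∑ s ∈ IS, ‖α r s‖ ^ 2 with hN2
  -- the forms
  set cls : ℕ → ℝ := fun d => ∑ a' ∈ range d, ‖∑ r ∈ IR, ∑ s ∈ IS,
      (if r.Coprime d ∧ (d : ℤ) ∣ (s : ℤ) - (a' : ℤ) * r then α r s * (J((d : ℤ) | r) : ℂ)
        else 0)‖ ^ 2 with hcls
  set Tm : ℕ → ℂ := fun d => ∑ r₁ ∈ IR, ∑ s₁ ∈ IS, ∑ r₂ ∈ IR, ∑ s₂ ∈ IS,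
      (if (d : ℤ) ∣ (r₁ : ℤ) * s₂ - (r₂ : ℤ) * s₁ then
        α r₁ s₁ * conj (α r₂ s₂) * (J((d : ℤ) | r₁ * r₂) : ℂ) else 0) with hTm
  set Tg : ℕ → ℂ := fun d => ∑ r₁ ∈ IR, ∑ s₁ ∈ IS, ∑ r₂ ∈ IR, ∑ s₂ ∈ IS,
      (if (d : ℤ) ∣ (r₁ : ℤ) * s₂ - (r₂ : ℤ) * s₁ then
        α r₁ s₁ * conj (α r₂ s₂) * (J((d : ℤ) | r₁ * r₂) : ℂ) *
          (g |(s₁ : ℝ) / r₁ - (s₂ : ℝ) / r₂| : ℂ) else 0) with hTg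
  set T0 : ℕ → ℂ := fun d => ∑ r₁ ∈ IR, ∑ s₁ ∈ IS, ∑ r₂ ∈ IR, ∑ s₂ ∈ IS,
      (if (d : ℤ) ∣ (r₁ : ℤ) * s₂ - (r₂ : ℤ) * s₁ then
        α r₁ s₁ * conj (α r₂ s₂) * (J((d : ℤ) | r₁ * r₂) : ℂ) *
          ((1 - g |(s₁ : ℝ) / r₁ - (s₂ : ℝ) / r₂| : ℝ) : ℂ) else 0) with hT0
  -- Step 1: squaring out over the classes
  have hcls_eq : ∀ d : ℕ, 0 < d → ((cls d : ℝ) : ℂ) = Tm d := by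
    intro d hd
    have hsq : ((cls d : ℝ) : ℂ) = ∑ a' ∈ range d,
        (∑ r ∈ IR, ∑ s ∈ IS, (if r.Coprime d ∧ (d : ℤ) ∣ (s : ℤ) - (a' : ℤ) * r then
          α r s * (J((d : ℤ) | r) : ℂ) else 0)) *
        conj (∑ r ∈ IR, ∑ s ∈ IS, (if r.Coprime d ∧ (d : ℤ) ∣ (s : ℤ) - (a' : ℤ) * r then
          α r s * (J((d : ℤ) | r) : ℂ) else 0)) := by
      simp only [hcls]
      push_cast
      refine sum_congr rfl fun a' _ => ?_
      rw [Complex.mul_conj']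
    rw [hsq, bilinear_congr_eq_sum_classes hd IR IS]
    simp only [hTm]
    refine sum_congr rfl fun r₁ hr₁ => sum_congr rfl fun s₁ _ => sum_congr rfl fun r₂ hr₂ =>
      sum_congr rfl fun s₂ _ => ?_
    have hr₁0 : r₁ ≠ 0 := by have := (mem_Ioc.mp hr₁).1; omega
    have hr₂0 : r₂ ≠ 0 := by have := (mem_Ioc.mp hr₂).1; omega
    by_cases hc : r₁.Coprime d ∧ r₂.Coprime d
    · by_cases hdvd : (d : ℤ) ∣ (r₁ : ℤ) * s₂ - (r₂ : ℤ) * s₁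
      · rw [if_pos ⟨hc.1, hc.2, hdvd⟩, if_pos hdvd, jacobiSym.mul_right' _ hr₁0 hr₂0, map_mul,
          map_intCast]
        push_cast
        ring
      · rw [if_neg (fun h => hdvd h.2.2), if_neg hdvd]
    · rw [if_neg (fun h => hc ⟨h.1, h.2.1⟩)]
      split_ifs with hdvd
      · have hJ : J((d : ℤ) | r₁ * r₂) = 0 := by
          rw [jacobiSym.eq_zero_iff]
          refine ⟨mul_ne_zero hr₁0 hr₂0, fun hg => hc ?_⟩
          rw [Int.gcd_natCast_natCast] at hg
          exact ⟨(Nat.Coprime.coprime_dvd_right ⟨r₂, rfl⟩ hg).symm,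
            (Nat.Coprime.coprime_dvd_right ⟨r₁, by ring⟩ hg).symm⟩
        rw [hJ, Int.cast_zero, mul_zero]
      · rfl
  have hcls_nonneg : ∀ d, 0 ≤ cls d := fun d => by
    simp only [hcls]
    exact sum_nonneg fun _ _ => by positivity
  -- Step 2: the majorant
  have h2 : ∑ d ∈ Ioc D (2 * D), cls d ≤ ∑ d ∈ Ioc 0 N, F ((d : ℝ) / D) * cls d := by
    have hsub : Ioc D (2 * D) ⊆ Ioc 0 N := Ioc_subset_Ioc (Nat.zero_le D) hN
    calc ∑ d ∈ Ioc D (2 * D), cls d = ∑ d ∈ Ioc D (2 * D), F ((d : ℝ) / D) * cls d := by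
          refine sum_congr rfl fun d hd => ?_
          have hd' := mem_Ioc.mp hd
          have hD0 : (0 : ℝ) < D := by exact_mod_cast (show 0 < D by omega)
          have h1 : (1 : ℝ) ≤ (d : ℝ) / D := by
            rw [le_div_iff₀ hD0, one_mul]; exact_mod_cast hd'.1.le
          have h2 : (d : ℝ) / D ≤ 2 := by
            rw [div_le_iff₀ hD0]; exact_mod_cast hd'.2
          rw [hF2 _ ⟨h1, h2⟩, one_mul]
      _ ≤ ∑ d ∈ Ioc 0 N, F ((d : ℝ) / D) * cls d :=
          sum_le_sum_of_subset_of_nonneg hsub fun d _ _ => mul_nonneg (hF0 _) (hcls_nonneg d)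
  -- Step 3: as a complex number, split `1 = g + (1 - g)`
  have h3 : ((∑ d ∈ Ioc 0 N, F ((d : ℝ) / D) * cls d : ℝ) : ℂ) =
      ∑ d ∈ Ioc 0 N, (F ((d : ℝ) / D) : ℂ) * Tg d + ∑ d ∈ Ioc 0 N, (F ((d : ℝ) / D) : ℂ) * T0 d := by
    rw [← sum_add_distrib]
    push_cast
    refine sum_congr rfl fun d hd => ?_
    have hd0 : 0 < d := (mem_Ioc.mp hd).1
    rw [hcls_eq d hd0, ← mul_add]
    congr 1
    simp only [hTm, hTg, hT0, ← sum_add_distrib]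
    refine sum_congr rfl fun r₁ _ => sum_congr rfl fun s₁ _ => sum_congr rfl fun r₂ _ =>
      sum_congr rfl fun s₂ _ => ?_
    split_ifs
    · push_cast; ring
    · simp
  -- Step 4: the exceptional points
  set 𝒟 := (Ioc 0 N).filter (fun d : ℕ => F ((d : ℝ) / D) ≠ 0) with h𝒟def
  have hD0r : (0 : ℝ) < (D : ℝ) / 2 ∨ D = 0 := by
    rcases Nat.eq_zero_or_pos D with h | h
    · exact Or.inr h
    · left
      have : (0 : ℝ) < D := by exact_mod_cast h
      positivity
  have h4 : ‖∑ d ∈ Ioc 0 N, (F ((d : ℝ) / D) : ℂ) * T0 d‖ ≤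
      ∑ d ∈ 𝒟, ∑ r₁ ∈ IR, ∑ s₁ ∈ IS, ∑ r₂ ∈ IR, ∑ s₂ ∈ IS,
        (if |(s₁ : ℝ) / r₁ - (s₂ : ℝ) / r₂| < 2 * a ∧ (d : ℤ) ∣ (r₁ : ℤ) * s₂ - (r₂ : ℤ) * s₁ then
          ‖α r₁ s₁‖ * ‖α r₂ s₂‖ else 0) := by
    -- termwise majorant
    have hterm : ∀ d : ℕ, ∀ r₁ ∈ IR, ∀ s₁ ∈ IS, ∀ r₂ ∈ IR, ∀ s₂ ∈ IS,
        ‖(if (d : ℤ) ∣ (r₁ : ℤ) * s₂ - (r₂ : ℤ) * s₁ then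
          α r₁ s₁ * conj (α r₂ s₂) * (J((d : ℤ) | r₁ * r₂) : ℂ) *
            ((1 - g |(s₁ : ℝ) / r₁ - (s₂ : ℝ) / r₂| : ℝ) : ℂ) else 0)‖ ≤
        (if |(s₁ : ℝ) / r₁ - (s₂ : ℝ) / r₂| < 2 * a ∧ (d : ℤ) ∣ (r₁ : ℤ) * s₂ - (r₂ : ℤ) * s₁ then
          ‖α r₁ s₁‖ * ‖α r₂ s₂‖ else 0) := by
      intro d r₁ hr₁ s₁ hs₁ r₂ hr₂ s₂ hs₂
      have hlt := abs_sub_div_lt_of_mem_box hr₁ hs₁ hr₂ hs₂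
      set x : ℝ := |(s₁ : ℝ) / r₁ - (s₂ : ℝ) / r₂| with hxdef
      have hgx0 := hg0 x
      have hgx1 := hg1 x
      by_cases hdvd : (d : ℤ) ∣ (r₁ : ℤ) * s₂ - (r₂ : ℤ) * s₁
      · rw [if_pos hdvd]
        by_cases hx : x < 2 * a
        · rw [if_pos ⟨hx, hdvd⟩, norm_mul, norm_mul, norm_mul, Complex.norm_conj,
            Complex.norm_real, Real.norm_eq_abs]
          have hJ := norm_jacobiSym_le_one' (d : ℤ) (r₁ * r₂)
          have hg' : |1 - g x| ≤ 1 := by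
            rw [abs_le]
            constructor <;> linarith
          calc ‖α r₁ s₁‖ * ‖α r₂ s₂‖ * ‖(J((d : ℤ) | r₁ * r₂) : ℂ)‖ * |1 - g x|
              ≤ ‖α r₁ s₁‖ * ‖α r₂ s₂‖ * 1 * 1 := by
                gcongr
            _ = ‖α r₁ s₁‖ * ‖α r₂ s₂‖ := by ring
        · -- `g = 1` here
          have hg1' : g x = 1 := hg2 _ (not_lt.mp hx) hlt.le
          rw [hg1', sub_self, Complex.ofReal_zero, mul_zero, norm_zero]
          split_ifs <;> positivity
      · rw [if_neg hdvd, norm_zero]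
        split_ifs <;> positivity
    calc ‖∑ d ∈ Ioc 0 N, (F ((d : ℝ) / D) : ℂ) * T0 d‖
        ≤ ∑ d ∈ Ioc 0 N, ‖(F ((d : ℝ) / D) : ℂ) * T0 d‖ := norm_sum_le _ _
      _ = ∑ d ∈ 𝒟, ‖(F ((d : ℝ) / D) : ℂ) * T0 d‖ := by
          rw [h𝒟def, sum_filter_of_ne]
          intro d _ hne hF
          apply hne
          rw [hF, Complex.ofReal_zero, zero_mul, norm_zero]
      _ ≤ ∑ d ∈ 𝒟, ‖T0 d‖ := by
          refine sum_le_sum fun d _ => ?_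
          rw [norm_mul, Complex.norm_real, Real.norm_eq_abs, abs_of_nonneg (hF0 _)]
          exact mul_le_of_le_one_left (norm_nonneg _) (hF1 _)
      _ ≤ _ := by
          refine sum_le_sum fun d _ => ?_
          simp only [hT0]
          refine (norm_sum_le _ _).trans (sum_le_sum fun r₁ hr₁ => ?_)
          refine (norm_sum_le _ _).trans (sum_le_sum fun s₁ hs₁ => ?_)
          refine (norm_sum_le _ _).trans (sum_le_sum fun r₂ hr₂ => ?_)
          refine (norm_sum_le _ _).trans (sum_le_sum fun s₂ hs₂ => ?_)
          exact hterm d r₁ hr₁ s₁ hs₁ r₂ hr₂ s₂ hs₂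
  -- Step 5: the excision count
  have h5 : ∑ d ∈ 𝒟, ∑ r₁ ∈ IR, ∑ s₁ ∈ IS, ∑ r₂ ∈ IR, ∑ s₂ ∈ IS,
      (if |(s₁ : ℝ) / r₁ - (s₂ : ℝ) / r₂| < 2 * a ∧ (d : ℤ) ∣ (r₁ : ℤ) * s₂ - (r₂ : ℤ) * s₁ then
        ‖α r₁ s₁‖ * ‖α r₂ s₂‖ else 0) ≤
      (3 * D + (48 * a * (R : ℝ) ^ 2 * (1 + Real.log (1 + 16 * (R : ℝ) ^ 2 * a / D)) +
        3 * (16 * (R : ℝ) ^ 2 * a / D) * Real.sqrt ((R : ℝ) * S))) * N2 := by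
    rcases hD0r with hD0 | hDz
    · have h𝒟 : ∀ d ∈ 𝒟, (D : ℝ) / 2 < d := by
        intro d hd
        rw [h𝒟def, mem_filter] at hd
        by_contra hle
        exact hd.2 (hF3 _ (by
          have hDp : (0 : ℝ) < D := by linarith
          rw [div_le_iff₀ hDp]
          linarith [not_lt.mp hle]))
      have hcard : (#𝒟 : ℝ) ≤ 3 * D := by
        have hsub : 𝒟 ⊆ Ioc 0 (3 * D) := by
          intro d hd
          rw [h𝒟def, mem_filter, mem_Ioc] at hd
          rw [mem_Ioc]
          refine ⟨hd.1.1, ?_⟩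
          by_contra hlt
          have hDp : (0 : ℝ) < D := by linarith
          refine hd.2 (hF4 _ ?_)
          rw [le_div_iff₀ hDp]
          have : (3 * D : ℝ) < d := by exact_mod_cast (not_le.mp hlt)
          linarith
        calc (#𝒟 : ℝ) ≤ #(Ioc 0 (3 * D)) := by exact_mod_cast card_le_card hsub
          _ = 3 * D := by rw [Nat.card_Ioc, Nat.sub_zero]; push_cast; ring
      have hX : (0 : ℝ) < 2 * a := by positivity
      have hex := sum_nearDiagonal_norm_le (R := R) hS hX hD0 𝒟 h𝒟 α hα
      have e1 : 24 * (2 * a) * (R : ℝ) ^ 2 = 48 * a * (R : ℝ) ^ 2 := by ring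
      have e2 : 4 * (R : ℝ) ^ 2 * (2 * a) / ((D : ℝ) / 2) = 16 * (R : ℝ) ^ 2 * a / D := by
        field_simp
        ring
      rw [e1, e2] at hex
      refine hex.trans ?_
      have hN2' : 0 ≤ N2 := by rw [hN2]; positivity
      have hlog : 0 ≤ Real.log (1 + 16 * (R : ℝ) ^ 2 * a / D) := by
        refine Real.log_nonneg ?_
        have : 0 ≤ 16 * (R : ℝ) ^ 2 * a / D := by positivity
        linarith
      gcongr
    · -- `D = 0`: the set `𝒟` is empty
      have h𝒟e : 𝒟 = ∅ := by
        rw [h𝒟def, filter_eq_empty_iff]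
        intro d _ h
        apply h
        rw [hDz, Nat.cast_zero, div_zero]
        exact hF3 0 (by norm_num)
      rw [h𝒟e, sum_empty]
      have hN2' : 0 ≤ N2 := by rw [hN2]; positivity
      rw [hDz, Nat.cast_zero]
      simp only [mul_zero, div_zero, add_zero, Real.log_one, mul_one, zero_mul, zero_add]
      positivity
  -- assembly
  have hM : ∑ d ∈ Ioc 0 N, F ((d : ℝ) / D) * cls d ≤
      ‖∑ d ∈ Ioc 0 N, (F ((d : ℝ) / D) : ℂ) * Tg d‖ + ‖∑ d ∈ Ioc 0 N, (F ((d : ℝ) / D) : ℂ) * T0 d‖ := by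
    have hnn : 0 ≤ ∑ d ∈ Ioc 0 N, F ((d : ℝ) / D) * cls d :=
      sum_nonneg fun d _ => mul_nonneg (hF0 _) (hcls_nonneg d)
    calc ∑ d ∈ Ioc 0 N, F ((d : ℝ) / D) * cls d
        = ‖((∑ d ∈ Ioc 0 N, F ((d : ℝ) / D) * cls d : ℝ) : ℂ)‖ := by
          rw [Complex.norm_real, Real.norm_eq_abs, abs_of_nonneg hnn]
      _ ≤ _ := by rw [h3]; exact norm_add_le _ _
  calc ∑ d ∈ Ioc D (2 * D), cls d ≤ ∑ d ∈ Ioc 0 N, F ((d : ℝ) / D) * cls d := h2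
    _ ≤ ‖∑ d ∈ Ioc 0 N, (F ((d : ℝ) / D) : ℂ) * Tg d‖ +
          ‖∑ d ∈ Ioc 0 N, (F ((d : ℝ) / D) : ℂ) * T0 d‖ := hM
    _ ≤ ‖∑ d ∈ Ioc 0 N, (F ((d : ℝ) / D) : ℂ) * Tg d‖ +
          (3 * D + (48 * a * (R : ℝ) ^ 2 * (1 + Real.log (1 + 16 * (R : ℝ) ^ 2 * a / D)) +
            3 * (16 * (R : ℝ) ^ 2 * a / D) * Real.sqrt ((R : ℝ) * S))) * N2 := by
          gcongr
          exact h4.trans h5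

end Literature.NumberTheory.Sieve.FriedlanderIwaniecPrimes
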